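import Mathlib
import Summits.Ventures.PercRepro2.LocRows
import Summits.Ventures.PercRepro2.SwRow
import Summits.Ventures.PercRepro2.SwOut
import Summits.Ventures.PercRepro2.SwAllRow
import Summits.Ventures.PercRepro2.SwOutAll
import Summits.Ventures.PercRepro2.SwOutArmFlip
import Summits.Ventures.PercRepro2.SwOutArmThm
import Summits.Ventures.PercRepro2.SwOutCoreDefs
import Summits.Ventures.PercRepro2.SwOutBigBlockDefs
import Summits.Ventures.PercRepro2.SwOutMixedBaseDefs
import Summits.Ventures.PercRepro2.SwOutMixedBaseClasses
import Summits.Ventures.PercRepro2.SwOutMixedBaseHull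
import Summits.Ventures.PercRepro2.SwOutMixedBaseDual
import Summits.Ventures.PercRepro2.SwOutMixedCore
import Summits.Ventures.PercRepro2.SwOutMixedCoreEdgeMap

/-!
# The outside-edge move of the mixed single junction (blind cell PercRepro2, night-4 g18,
2026-08-27; proofs/NIGHT4-G18.md §5, item (G3) of NIGHT4-G17.md §4⁗′: the `e`-moves)

The coordinate `e` of the raw cube is «the outside edges of `p` are BLUE»; the move `toggleE`
from `e = true` to `e = false` turns them red and nothing else.  It only ADDS red edges, so the red
cluster of `l` grows and the blue cluster of `l` shrinks (`mixedReal_le_toggleE`), and at every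
non-leaking target point `h` is outside the hull of `l` because `l` is outside the region that
contains the hull of `h` (`hull_mixedReal_subset`): the conditioning `tgtU` is kept
(`mem_tgtU_of_le_of_not_mem_hull`, `mem_tgtU_toggleE`).  This covers the block moves
`D(1,a,f) → (⊤,a,0,0,f)` (to `x(f)` / `F(⊤,0,f)`), `x̄(f) → D(0,0,f)` and `F(⊥,1,f) → D(0,1,f)`
— at EVERY point, mixed or not (no junction enters).
-/

namespace Summit.Ventures.PercRepro2

namespace BigBlock

open Hull LocRows

variable {V : Type*} {E : Type*}

section Generic

variable [Fintype E] [DecidableEq E] {ends : E → Sym2 V}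

open scoped Classical in
omit [Fintype E] [DecidableEq E] in
/-- Redder colourings have smaller blue colourings. -/
lemma blue_le_blue_of_le' {ζ ζ' : Config E} (h : ζ ≤ ζ') : blue ζ' ≤ blue ζ := by
  intro e
  have := h e
  simp only [blue]
  cases h1 : ζ e <;> cases h2 : ζ' e <;> simp_all

/-- **Adding red edges keeps the conditioning** when `h` stays outside the hull of `l`: the red
cluster of `l` grows, the blue cluster of `l` shrinks. -/
lemma mem_tgtU_of_le_of_not_mem_hull {ζ ζ' : Config E} {l h o : V} (hle : ζ ≤ ζ')
    (hlh : l ∉ hull ends ζ' h) (hQ : ζ ∈ tgtU ends l h {S : Set V | o ∈ S}) :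
    ζ' ∈ tgtU ends l h {S : Set V | o ∈ S} := by
  simp only [tgtU, Finset.mem_filter, Finset.mem_univ, true_and, Set.mem_setOf_eq, hull,
    Set.mem_union, not_or] at hQ hlh ⊢
  obtain ⟨_, hoA, hoB⟩ := hQ
  refine ⟨⟨fun hh => hlh.1 (conn_symm hh), fun hh => hlh.2 (conn_symm hh)⟩,
    cluster_mono hle l hoA, fun h' => hoB (cluster_mono (blue_le_blue_of_le' hle) l h')⟩

end Generic

section MoveE

variable {ι κ : Type*}

/-- The move toggling the outside edges of `p`. -/
def toggleE (q : Pt ι κ) : Pt ι κ := (q.1, q.2.1, q.2.2.1, !q.2.2.2.1, q.2.2.2.2)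

variable {ends : E → Sym2 V} {σ : Config E} {h u p : V} {U : ι → Set V} {Ah : Set V}
  {F : κ → Set V} (hb : MixedBase ends σ h u p U Ah F)
include hb

omit hb in
/-- Off the outside edges of `p`, the move `toggleE` changes nothing. -/
lemma mixedReal_toggleE_of_notMem {q : Pt ι κ} {e : E} (he : e ∉ clsExt ends u p Ah) :
    mixedReal ends u p U Ah F σ (toggleE q) e = mixedReal ends u p U Ah F σ q e := by
  have key : e ∈ flipSet ends u p U Ah F (toggleE q) ↔ e ∈ flipSet ends u p U Ah F q := by
    simp only [flipSet, toggleE, Set.mem_union, Set.mem_setOf_eq, he, and_false, or_false]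
  unfold mixedReal
  by_cases hf : e ∈ flipSet ends u p U Ah F q
  · rw [if_pos (key.2 hf), if_pos hf]
  · rw [if_neg (fun h' => hf (key.1 h')), if_neg hf]

/-- **The move `toggleE` from `e = true` only adds red edges** (the outside edges of `p` are blue
at the base). -/
lemma MixedBase.mixedReal_le_toggleE {q : Pt ι κ} (he : q.2.2.2.1 = true) :
    mixedReal ends u p U Ah F σ q ≤ mixedReal ends u p U Ah F σ (toggleE q) := by
  intro e
  by_cases hx : e ∈ clsExt ends u p Ah
  · rw [hb.mixedReal_apply_Ext hx, if_pos he]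
    obtain ⟨x, hpx, hxu, hxA⟩ := hx
    rw [hb.ext_blue e x hpx hxu hxA]
    exact Bool.false_le _
  · rw [mixedReal_toggleE_of_notMem hx]

/-- **The outside-edge move keeps the conditioning** at every point whose target is non-leaking
(`e`: blue → red), the region `Us` containing `h`, `u`, `p` and the arms and not `l`. -/
theorem MixedBase.mem_tgtU_toggleE [Fintype E] [DecidableEq E] (hup : ∃ e, ends e = s(u, p))
    {Us : Set V} {l o : V} (hUs : {h} ∪ {u} ∪ {p} ∪ armsAll U Ah F ⊆ Us) (hl : l ∉ Us)
    {q : Pt ι κ} (he : q.2.2.2.1 = true) (hqR : ¬ LeakR (toggleE q)) (hqB : ¬ LeakB (toggleE q))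
    (hQ : mixedReal ends u p U Ah F σ q ∈ tgtU ends l h {S : Set V | o ∈ S}) :
    mixedReal ends u p U Ah F σ (toggleE q) ∈ tgtU ends l h {S : Set V | o ∈ S} :=
  mem_tgtU_of_le_of_not_mem_hull (hb.mixedReal_le_toggleE he)
    (fun hl' => hl (hUs (hb.hull_mixedReal_subset hup hqR hqB hl'))) hQ

end MoveE

end BigBlock

end Summit.Ventures.PercRepro2
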